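import Mathlib
import Literature.NumberTheory.GaloisRepresentations.FramedRepDualProofs
import Summits.Langlands.Langlands.Theorems.DisagreementBeurlingDefectTable36Inv
import HarnessLib

/-!
# DisagreementBeurling — `DefectTable36`, part 3: eigenvalues and the character count

Linear algebra over `ℂ` and the character-orthogonality count behind the support item
`Summit.Langlands.Langlands.Theses.DisagreementBeurling.DefectTable36` (stmt-Langlands-13936).

* §4 complex-number lemmas: fourth roots of unity, `1 ≤ |1 + u + w|²` for `u⁴ = w⁴ = 1`,
  `|2b + c|² ∈ {0, 1}` is impossible for unit `b, c` with `c² ≠ b²`, and the positive gaps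
  `|Σα|² − |Σβ|² > 0` for `β = {b, −b, c}`, `α ∈ {{b, b, −c}, {−b, −b, −c}}`;
* §5 eigenvectors: a root `μ` of the characteristic polynomial of `M` with `Mᵏ = κ • 1` has
  `μᵏ = κ`; hence `1 ≤ |tr M|²` when `M` has finite order and `M⁴` is scalar (`3 × 3`;
  unimodularity of the roots is the tree's `Matrix.norm_eq_one_of_mem_roots_charpoly_of_pow_eq_one`);
* §6 the count: for a finite subgroup `G ≤ GL₃(ℂ)` acting irreducibly (input as the
  orthogonality relation `Σ_g |tr g|² = |G|`) whose projective image `Q` has order `36`, trivial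
  centre and an element of order `4`, the class function `f = 9·[q = 1] + [q ∉ P]` on `Q`
  (`P` the normal subgroup of order `9` of parts 1–2) satisfies `f ∘ π ≤ |tr|²` pointwise and
  has the same sum, so `|tr g|² = f(π g)` for every `g`; consequently no `g ∈ G` has eigenvalue
  multiset `{b, b, c}` with `|b| = |c| = 1`, `c² ≠ b²` (**no homology class**).

No named facts are assumed. [folklore]
-/

set_option linter.dupNamespace false

open scoped BigOperators

namespace Summit.Langlands.Langlands.Theorems.DisagreementBeurlingDefectTable36

/-! ### §4 Complex-number lemmas -/

section ComplexLemmas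

/-- `1 ≤ |1 + u + w|²` for fourth roots of unity `u, w`. [folklore] -/
theorem one_le_norm_sq_one_add_add {u w : ℂ} (hu : u ^ 4 = 1) (hw : w ^ 4 = 1) :
    1 ≤ ‖1 + u + w‖ ^ 2 := by
  -- census inline (G41 b): `dedup.landed` vs Literature.Probability.Process.norm_sq_eq_re_sq_add_im_sq — local copy instead of a top-level restatement
  have norm_sq_eq_re_sq_add_im_sq : ∀ z : ℂ, ‖z‖ ^ 2 = z.re ^ 2 + z.im ^ 2 := fun z => by
    rw [Complex.sq_norm, Complex.normSq_apply]; ring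
  -- census inline (G41 b): `dedup.landed` vs Literature.AlgebraicGeometry.HodgeTheory.eq_of_pow_four_eq_one
  have eq_of_pow_four_eq_one : ∀ {u : ℂ}, u ^ 4 = 1 → (u = 1 ∨ u = -1 ∨ u = Complex.I ∨ u = -Complex.I) := by
    intro u hu
    have h : (u ^ 2 - 1) * (u ^ 2 + 1) = 0 := by linear_combination hu
    rcases mul_eq_zero.mp h with h1 | h1
    · have : u ^ 2 = 1 ^ 2 := by linear_combination h1
      rcases sq_eq_sq_iff_eq_or_eq_neg.mp this with h2 | h2
      · exact Or.inl h2
      · exact Or.inr (Or.inl h2)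
    · have : u ^ 2 = Complex.I ^ 2 := by rw [Complex.I_sq]; linear_combination h1
      rcases sq_eq_sq_iff_eq_or_eq_neg.mp this with h2 | h2
      · exact Or.inr (Or.inr (Or.inl h2))
      · exact Or.inr (Or.inr (Or.inr h2))
  rw [norm_sq_eq_re_sq_add_im_sq]
  rcases eq_of_pow_four_eq_one hu with rfl | rfl | rfl | rfl <;>
  rcases eq_of_pow_four_eq_one hw with rfl | rfl | rfl | rfl <;>
  simp <;> norm_num

/-- `1 ≤ |μ₁ + μ₂ + μ₃|²` when `|μ₁| = 1` and `μ₁⁴ = μ₂⁴ = μ₃⁴`. [folklore] -/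
theorem one_le_norm_sq_add_three {μ₁ μ₂ μ₃ κ : ℂ} (h₁ : ‖μ₁‖ = 1) (hk₁ : μ₁ ^ 4 = κ)
    (hk₂ : μ₂ ^ 4 = κ) (hk₃ : μ₃ ^ 4 = κ) : 1 ≤ ‖μ₁ + μ₂ + μ₃‖ ^ 2 := by
  have hμ₁ : μ₁ ≠ 0 := by
    intro h
    rw [h, norm_zero] at h₁
    exact zero_ne_one h₁
  have h4 : μ₁ ^ 4 ≠ 0 := pow_ne_zero 4 hμ₁
  have hu : (μ₂ / μ₁) ^ 4 = 1 := by rw [div_pow, hk₂, ← hk₁]; exact div_self h4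
  have hw : (μ₃ / μ₁) ^ 4 = 1 := by rw [div_pow, hk₃, ← hk₁]; exact div_self h4
  have : μ₁ + μ₂ + μ₃ = μ₁ * (1 + μ₂ / μ₁ + μ₃ / μ₁) := by field_simp
  rw [this, norm_mul, mul_pow, h₁, one_pow, one_mul]
  exact one_le_norm_sq_one_add_add hu hw

/-- `b + b + c ≠ 0` for unit `b, c`. [folklore] -/
theorem add_add_ne_zero_of_norm_one {b c : ℂ} (hb : ‖b‖ = 1) (hc : ‖c‖ = 1) :
    b + b + c ≠ 0 := by
  intro h
  have hc' : c = -(2 * b) := by linear_combination h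
  rw [hc', norm_neg, norm_mul, hb, Complex.norm_ofNat] at hc
  norm_num at hc

/-- If `|b| = |c| = 1` and `|b + b + c|² = 1` then `c = −b`, so `c² = b²`. [folklore] -/
theorem sq_eq_sq_of_norm_sq_add_add_eq_one {b c : ℂ} (hb : ‖b‖ = 1) (hc : ‖c‖ = 1)
    (h : ‖b + b + c‖ ^ 2 = 1) : c ^ 2 = b ^ 2 := by
  -- census inline (G41 b): `dedup.landed` vs Literature.Probability.Process.norm_sq_eq_re_sq_add_im_sq — local copy instead of a top-level restatement
  have norm_sq_eq_re_sq_add_im_sq : ∀ z : ℂ, ‖z‖ ^ 2 = z.re ^ 2 + z.im ^ 2 := fun z => by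
    rw [Complex.sq_norm, Complex.normSq_apply]; ring
  rw [norm_sq_eq_re_sq_add_im_sq] at h
  have hb' : b.re ^ 2 + b.im ^ 2 = 1 := by rw [← norm_sq_eq_re_sq_add_im_sq, hb, one_pow]
  have hc' : c.re ^ 2 + c.im ^ 2 = 1 := by rw [← norm_sq_eq_re_sq_add_im_sq, hc, one_pow]
  simp only [Complex.add_re, Complex.add_im] at h
  have e : (b.re + c.re) ^ 2 + (b.im + c.im) ^ 2 = 0 := by
    linear_combination (-1 : ℝ) * hb' + (1 / 2 : ℝ) * hc' + (1 / 2 : ℝ) * h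
  have hre : b.re + c.re = 0 := by nlinarith [sq_nonneg (b.re + c.re), sq_nonneg (b.im + c.im)]
  have him : b.im + c.im = 0 := by nlinarith [sq_nonneg (b.re + c.re), sq_nonneg (b.im + c.im)]
  have hcb : c = -b := Complex.ext (by simp; linarith) (by simp; linarith)
  rw [hcb, neg_sq]

/-- The gap for `α = {b, b, −c}` against `β = {b, −b, c}`: `|2b − c|² − |c|² = 2|b − c|² > 0`
when `|b| = |c| = 1` and `c ≠ b`. [folklore] -/
theorem gap_pos_of_ne {b c : ℂ} (hb : ‖b‖ = 1) (hc : ‖c‖ = 1) (hne : c ≠ b) :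
    0 < ‖b + (b + -c)‖ ^ 2 - ‖b + (-b + c)‖ ^ 2 := by
  -- census inline (G41 b): `dedup.landed` vs Literature.Probability.Process.norm_sq_eq_re_sq_add_im_sq — local copy instead of a top-level restatement
  have norm_sq_eq_re_sq_add_im_sq : ∀ z : ℂ, ‖z‖ ^ 2 = z.re ^ 2 + z.im ^ 2 := fun z => by
    rw [Complex.sq_norm, Complex.normSq_apply]; ring
  have hb' : b.re ^ 2 + b.im ^ 2 = 1 := by rw [← norm_sq_eq_re_sq_add_im_sq, hb, one_pow]
  have hc' : c.re ^ 2 + c.im ^ 2 = 1 := by rw [← norm_sq_eq_re_sq_add_im_sq, hc, one_pow]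
  have hpos : 0 < (b.re - c.re) ^ 2 + (b.im - c.im) ^ 2 := by
    by_contra hle
    push Not at hle
    have hre : b.re - c.re = 0 := by nlinarith [sq_nonneg (b.re - c.re), sq_nonneg (b.im - c.im)]
    have him : b.im - c.im = 0 := by nlinarith [sq_nonneg (b.re - c.re), sq_nonneg (b.im - c.im)]
    exact hne (Complex.ext (by linarith) (by linarith))
  rw [norm_sq_eq_re_sq_add_im_sq, norm_sq_eq_re_sq_add_im_sq]
  simp only [Complex.add_re, Complex.add_im, Complex.neg_re, Complex.neg_im]
  nlinarith [hpos, hb', hc']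

/-- The gap for `α = {−b, −b, −c}` against `β = {b, −b, c}`: `|2b + c|² − |c|² = 2|b + c|² > 0`
when `|b| = |c| = 1` and `c ≠ −b`. [folklore] -/
theorem gap_pos_of_ne_neg {b c : ℂ} (hb : ‖b‖ = 1) (hc : ‖c‖ = 1) (hne : c ≠ -b) :
    0 < ‖-b + (-b + -c)‖ ^ 2 - ‖b + (-b + c)‖ ^ 2 := by
  -- census inline (G41 b): `dedup.landed` vs Literature.Probability.Process.norm_sq_eq_re_sq_add_im_sq — local copy instead of a top-level restatement
  have norm_sq_eq_re_sq_add_im_sq : ∀ z : ℂ, ‖z‖ ^ 2 = z.re ^ 2 + z.im ^ 2 := fun z => by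
    rw [Complex.sq_norm, Complex.normSq_apply]; ring
  have hb' : b.re ^ 2 + b.im ^ 2 = 1 := by rw [← norm_sq_eq_re_sq_add_im_sq, hb, one_pow]
  have hc' : c.re ^ 2 + c.im ^ 2 = 1 := by rw [← norm_sq_eq_re_sq_add_im_sq, hc, one_pow]
  have hpos : 0 < (b.re + c.re) ^ 2 + (b.im + c.im) ^ 2 := by
    by_contra hle
    push Not at hle
    have hre : b.re + c.re = 0 := by nlinarith [sq_nonneg (b.re + c.re), sq_nonneg (b.im + c.im)]
    have him : b.im + c.im = 0 := by nlinarith [sq_nonneg (b.re + c.re), sq_nonneg (b.im + c.im)]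
    exact hne (Complex.ext (by simp; linarith) (by simp; linarith))
  rw [norm_sq_eq_re_sq_add_im_sq, norm_sq_eq_re_sq_add_im_sq]
  simp only [Complex.add_re, Complex.add_im, Complex.neg_re, Complex.neg_im]
  nlinarith [hpos, hb', hc']

end ComplexLemmas

/-! ### §5 Eigenvectors and the trace bound -/

section Eigen

variable {n : Type*} [Fintype n] [DecidableEq n]

/-- A root of the characteristic polynomial is an eigenvalue. [folklore] -/
theorem exists_eigenvector_of_mem_roots {M : Matrix n n ℂ} {μ : ℂ} (hμ : μ ∈ M.charpoly.roots) :
    ∃ v : n → ℂ, v ≠ 0 ∧ Matrix.mulVec M v = μ • v := by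
  have hroot : M.charpoly.eval μ = 0 := (Polynomial.mem_roots M.charpoly_monic.ne_zero).mp hμ
  rw [Matrix.eval_charpoly] at hroot
  obtain ⟨v, hv, hMv⟩ := Matrix.exists_mulVec_eq_zero_iff.mpr hroot
  refine ⟨v, hv, ?_⟩
  rw [Matrix.sub_mulVec, sub_eq_zero, Matrix.scalar_apply, Matrix.diagonal_const_mulVec] at hMv
  exact hMv.symm

/-- Powers act on an eigenvector by powers of the eigenvalue. [folklore] -/
theorem pow_mulVec_of_mulVec_eq_smul {M : Matrix n n ℂ} {μ : ℂ} {v : n → ℂ}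
    (h : Matrix.mulVec M v = μ • v) (k : ℕ) : Matrix.mulVec (M ^ k) v = μ ^ k • v := by
  induction k with
  | zero => simp
  | succ k ih =>
    rw [pow_succ, ← Matrix.mulVec_mulVec, h, Matrix.mulVec_smul, ih, smul_smul, pow_succ,
      mul_comm]

/-- If `Mᵏ = κ • 1` then every root `μ` of the characteristic polynomial of `M` has `μᵏ = κ`.
[folklore] -/
theorem root_pow_eq_of_pow_eq_smul_one {M : Matrix n n ℂ} {k : ℕ} {κ : ℂ}
    (hM : M ^ k = κ • (1 : Matrix n n ℂ)) {μ : ℂ} (hμ : μ ∈ M.charpoly.roots) : μ ^ k = κ := by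
  obtain ⟨v, hv, hMv⟩ := exists_eigenvector_of_mem_roots hμ
  have h1 := pow_mulVec_of_mulVec_eq_smul hMv k
  rw [hM, Matrix.smul_mulVec, Matrix.one_mulVec] at h1
  have : (μ ^ k - κ) • v = 0 := by rw [sub_smul, ← h1, sub_self]
  rcases smul_eq_zero.mp this with h | h
  · exact sub_eq_zero.mp h
  · exact absurd h hv

/-- A `3 × 3` complex matrix has exactly three characteristic roots (with multiplicity).
[folklore] -/
theorem card_roots_charpoly_eq_three (M : Matrix (Fin 3) (Fin 3) ℂ) :
    M.charpoly.roots.card = 3 := by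
  rw [← (IsAlgClosed.splits M.charpoly).natDegree_eq_card_roots, Matrix.charpoly_natDegree_eq_dim]
  simp

/-- **Trace bound.**  A `3 × 3` complex matrix of finite order whose fourth power is scalar has
`1 ≤ |tr M|²`. [folklore] -/
theorem one_le_norm_sq_trace {M : Matrix (Fin 3) (Fin 3) ℂ} {N : ℕ} (hN : N ≠ 0)
    (hMN : M ^ N = 1) {κ : ℂ} (hM4 : M ^ 4 = κ • (1 : Matrix (Fin 3) (Fin 3) ℂ)) :
    1 ≤ ‖M.trace‖ ^ 2 := by
  obtain ⟨μ₁, μ₂, μ₃, h3⟩ := Multiset.card_eq_three.mp (card_roots_charpoly_eq_three M)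
  have hm₁ : μ₁ ∈ M.charpoly.roots := by rw [h3]; simp
  have hm₂ : μ₂ ∈ M.charpoly.roots := by rw [h3]; simp
  have hm₃ : μ₃ ∈ M.charpoly.roots := by rw [h3]; simp
  rw [Matrix.trace_eq_sum_roots_charpoly, h3]
  simp only [Multiset.insert_eq_cons, Multiset.sum_cons, Multiset.sum_singleton, ← add_assoc]
  exact one_le_norm_sq_add_three
    (Matrix.norm_eq_one_of_mem_roots_charpoly_of_pow_eq_one (Nat.pos_of_ne_zero hN) hMN hm₁)
    (root_pow_eq_of_pow_eq_smul_one hM4 hm₁) (root_pow_eq_of_pow_eq_smul_one hM4 hm₂)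
    (root_pow_eq_of_pow_eq_smul_one hM4 hm₃)

/-- A scalar `3 × 3` matrix does not have characteristic roots `{b, b, c}` with `c² ≠ b²`.
[folklore] -/
theorem roots_scalar_ne {u b c : ℂ} (hcb : c ^ 2 ≠ b ^ 2) :
    (Matrix.scalar (Fin 3) u).charpoly.roots ≠ {b, b, c} := by
  intro h
  have key : ∀ μ ∈ (Matrix.scalar (Fin 3) u).charpoly.roots, μ = u := by
    intro μ hμ
    have h1 : (Matrix.scalar (Fin 3) u) ^ 1 = u • (1 : Matrix (Fin 3) (Fin 3) ℂ) := by
      rw [pow_one, Matrix.scalar_apply, ← Matrix.smul_one_eq_diagonal]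
    simpa using root_pow_eq_of_pow_eq_smul_one h1 hμ
  have hb : b = u := key b (by rw [h]; simp)
  have hc : c = u := key c (by rw [h]; simp)
  exact hcb (by rw [hb, hc])

end Eigen

/-! ### §6 The character count on a projective image of order `36` -/

section Count

/-- Summing a function of `π g` over `G` counts each fibre `|ker π|` times. [folklore] -/
theorem sum_comp_eq_card_ker_mul_sum {G Q : Type*} [Group G] [Group Q] [Fintype G] [Fintype Q]
    [DecidableEq Q] (π : G →* Q) (hπ : Function.Surjective π) (f : Q → ℝ) :
    ∑ g, f (π g) = Nat.card π.ker * ∑ q, f q := by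
  classical
  have hfib : ∀ q : Q, ((Finset.univ.filter (fun g : G => π g = q)).card : ℝ) = Nat.card π.ker := by
    intro q
    have e : {g : G // π g = q} ≃ π.ker :=
      (Equiv.subtypeEquivRight (fun g => by simp)).trans (MonoidHom.fiberEquivKerOfSurjective hπ q)
    rw [← Fintype.card_subtype, ← Nat.card_eq_fintype_card, Nat.card_congr e]
  calc ∑ g, f (π g) = ∑ g, ∑ q, (if π g = q then f q else 0) := by
        refine Finset.sum_congr rfl fun g _ => ?_
        rw [Finset.sum_ite_eq]
        simp
    _ = ∑ q, ∑ g, (if π g = q then f q else 0) := Finset.sum_comm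
    _ = ∑ q, (Nat.card π.ker : ℝ) * f q := by
        refine Finset.sum_congr rfl fun q _ => ?_
        rw [← Finset.sum_filter, Finset.sum_const, nsmul_eq_mul, hfib q]
    _ = Nat.card π.ker * ∑ q, f q := by rw [Finset.mul_sum]

/-- **No homology class.**  Let `G ≤ GL₃(ℂ)` be finite with `Σ_g |tr g|² = |G|` (irreducibility),
and let `π : G ↠ Q` have kernel the scalars of `G`, where `|Q| = 36`, `Z(Q) = 1` and `Q` has an
element of order `4`.  Then no `g ∈ G` has characteristic roots `{b, b, c}` with `|b| = |c| = 1`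
and `c² ≠ b²`. [folklore] -/
theorem roots_ne_of_count {G : Subgroup (GL (Fin 3) ℂ)} [Fintype G] {Q : Type*} [Group Q]
    [Finite Q] (π : G →* Q) (hπ : Function.Surjective π)
    (hker : ∀ g : G, π g = 1 ↔ (g : GL (Fin 3) ℂ) ∈ Subgroup.center (GL (Fin 3) ℂ))
    (h36 : Nat.card Q = 36) (hZ : Subgroup.center Q = ⊥) (h4 : ∃ q : Q, orderOf q = 4)
    (horth : ∑ g : G, ‖((g : GL (Fin 3) ℂ) : Matrix (Fin 3) (Fin 3) ℂ).trace‖ ^ 2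
      = Fintype.card G)
    (g : G) {b c : ℂ} (hb : ‖b‖ = 1) (hc : ‖c‖ = 1) (hcb : c ^ 2 ≠ b ^ 2) :
    ((g : GL (Fin 3) ℂ) : Matrix (Fin 3) (Fin 3) ℂ).charpoly.roots ≠ {b, b, c} := by
  classical
  haveI : Fintype Q := Fintype.ofFinite Q
  obtain ⟨P, hN, hP9, hP4⟩ := exists_normal_nine_pow_four h36 hZ h4
  -- kernel elements are scalar
  have hscal : ∀ g : G, π g = 1 →
      ∃ u : ℂˣ, ((g : GL (Fin 3) ℂ) : Matrix (Fin 3) (Fin 3) ℂ) = Matrix.scalar (Fin 3) (u : ℂ) := by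
    intro g hg
    have hmem := (hker g).mp hg
    rw [Matrix.GeneralLinearGroup.center_eq_range_scalar] at hmem
    obtain ⟨u, hu⟩ := hmem
    exact ⟨u, by rw [← hu]; rfl⟩
  -- elements of `G` have finite order
  have hN0 : Fintype.card G ≠ 0 := Fintype.card_ne_zero
  have hpowN : ∀ g : G,
      (((g : GL (Fin 3) ℂ) : Matrix (Fin 3) (Fin 3) ℂ)) ^ Fintype.card G = 1 := by
    intro g
    have h := pow_card_eq_one (G := G) (x := g)
    have h' : (g : GL (Fin 3) ℂ) ^ Fintype.card G = 1 := by
      rw [← Subgroup.coe_pow, h, Subgroup.coe_one]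
    rw [← Units.val_pow_eq_pow_val, h', Units.val_one]
  -- the class function
  set f : Q → ℝ := fun q => 9 * (if q = 1 then 1 else 0) + (if q ∉ P then 1 else 0) with hf
  -- pointwise bound `f (π g) ≤ |tr g|²`
  have hle : ∀ g : G, f (π g) ≤ ‖((g : GL (Fin 3) ℂ) : Matrix (Fin 3) (Fin 3) ℂ).trace‖ ^ 2 := by
    intro g
    by_cases h1 : π g = 1
    · obtain ⟨u, hu⟩ := hscal g h1
      have hu1 : ‖(u : ℂ)‖ = 1 := by
        apply Complex.norm_eq_one_of_pow_eq_one _ hN0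
        have h := hpowN g
        rwa [hu, ← map_pow, show (1 : Matrix (Fin 3) (Fin 3) ℂ) = Matrix.scalar (Fin 3) (1 : ℂ)
          from (map_one _).symm, Matrix.scalar_inj] at h
      simp only [hf, h1, if_true, mul_one]
      rw [hu, Matrix.scalar_apply, Matrix.trace_diagonal, Finset.sum_const, Finset.card_univ,
        Fintype.card_fin, nsmul_eq_mul, norm_mul, hu1]
      norm_num
    · by_cases hP : π g ∈ P
      · have : f (π g) = 0 := by simp [hf, h1, hP]
        rw [this]
        positivity
      · have hq4 := hP4 (π g) hP
        have hk1 : π (g ^ 4) = 1 := by rw [map_pow, hq4]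
        obtain ⟨u, hu⟩ := hscal (g ^ 4) hk1
        have hM4 : (((g : GL (Fin 3) ℂ) : Matrix (Fin 3) (Fin 3) ℂ)) ^ 4
            = (u : ℂ) • (1 : Matrix (Fin 3) (Fin 3) ℂ) := by
          have : (((g ^ 4 : G) : GL (Fin 3) ℂ) : Matrix (Fin 3) (Fin 3) ℂ)
              = (((g : GL (Fin 3) ℂ) : Matrix (Fin 3) (Fin 3) ℂ)) ^ 4 := by
            simp [Units.val_pow_eq_pow_val]
          rw [← this, hu, Matrix.scalar_apply, Matrix.smul_one_eq_diagonal]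
        have : f (π g) = 1 := by simp [hf, h1, hP]
        rw [this]
        exact one_le_norm_sq_trace hN0 (hpowN g) hM4
  -- `Σ_q f q = 36`
  have hcardQ : (Finset.univ : Finset Q).card = 36 := by
    rw [Finset.card_univ, ← Nat.card_eq_fintype_card, h36]
  have hcardP : (Finset.univ.filter (fun q : Q => q ∈ P)).card = 9 := by
    rw [← Fintype.card_subtype, ← Nat.card_eq_fintype_card]
    exact hP9
  have hcardP' : (Finset.univ.filter (fun q : Q => q ∉ P)).card = 27 := by
    have := Finset.card_filter_add_card_filter_not (s := (Finset.univ : Finset Q)) (fun q => q ∈ P)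
    rw [hcardQ, hcardP] at this
    omega
  have hsumQ : ∑ q : Q, f q = 36 := by
    simp only [hf, Finset.sum_add_distrib, ← Finset.mul_sum, Finset.sum_ite_eq', Finset.mem_univ,
      if_true, Finset.sum_boole, hcardP']
    norm_num
  -- `|ker π| · 36 = |G|`
  have hker36 : (Nat.card π.ker : ℝ) * 36 = Fintype.card G := by
    have h1 := π.ker.card_mul_index
    rw [Subgroup.index_ker, MonoidHom.range_eq_top.mpr hπ, Subgroup.card_top, h36,
      Nat.card_eq_fintype_card (α := G)] at h1
    exact_mod_cast h1
  have hsum : ∑ g : G, f (π g)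
      = ∑ g : G, ‖((g : GL (Fin 3) ℂ) : Matrix (Fin 3) (Fin 3) ℂ).trace‖ ^ 2 := by
    rw [sum_comp_eq_card_ker_mul_sum π hπ f, hsumQ, hker36, horth]
  have heq := (Finset.sum_eq_sum_iff_of_le (fun g _ => hle g)).mp hsum
  -- the three cases
  intro hroots
  have htr : ((g : GL (Fin 3) ℂ) : Matrix (Fin 3) (Fin 3) ℂ).trace = b + b + c := by
    rw [Matrix.trace_eq_sum_roots_charpoly, hroots]
    simp only [Multiset.insert_eq_cons, Multiset.sum_cons, Multiset.sum_singleton, ← add_assoc]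
  have hfg := heq g (Finset.mem_univ g)
  by_cases h1 : π g = 1
  · obtain ⟨u, hu⟩ := hscal g h1
    rw [hu] at hroots
    exact roots_scalar_ne hcb hroots
  · by_cases hP : π g ∈ P
    · have : f (π g) = 0 := by simp [hf, h1, hP]
      rw [this, htr] at hfg
      have h0 : b + b + c = 0 := by
        have := pow_eq_zero_iff (n := 2) two_ne_zero |>.mp hfg.symm
        exact norm_eq_zero.mp this
      exact add_add_ne_zero_of_norm_one hb hc h0
    · have : f (π g) = 1 := by simp [hf, h1, hP]
      rw [this, htr] at hfg
      exact hcb (sq_eq_sq_of_norm_sq_add_add_eq_one hb hc hfg.symm)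

end Count

end Summit.Langlands.Langlands.Theorems.DisagreementBeurlingDefectTable36
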